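import Literature.AlgebraicGeometry.Frobenioids.GeometricFrobenioidModel
import Literature.AlgebraicGeometry.Frobenioids.GeometricDivisorPrimes
import Literature.AlgebraicGeometry.Frobenioids.ArithmeticFrobenioidNonDilating
import Literature.AlgebraicGeometry.Frobenioids.ModelFrobenioidStandardProofs
import HarnessLib

/-!
# Frobenioids I, Theorem 6.2 (iii): `Φ` of Example 6.1 is non-dilating, `C_{K̃/K}` is not of group-like
# type, and the hypotheses of Theorem 5.2 for the geometric data — PROOF

Mochizuki, *The geometry of Frobenioids I: the general theory*, Kyushu J. Math. **62** (2008) 293–400,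
proof of Theorem 6.2 (iii), kurims text pp. 111–112: "The fact that `C` is not of group-like type is immediate
from our assumption that `D_K ≠ ∅` [and the definition of `Φ`]. It is immediate that every monomorphism of `D`
is an isomorphism, hence that `D` is of FSM-type [hence also of FSMFF-type — cf. §0]. If a `K`-linear
automorphism `α` of a finite extension `L ⊆ K̃` of `K` induces an automorphism of `Φ(L)` which preserves the
primes of `L`, then it is immediate from the fact that `α` induces an automorphism of the scheme `V[L]` that
`α` maps every prime divisor `D ∈ Φ(L)` to `D` [i.e., not to some `n · D`, where `n ≥ 2`]; thus, we conclude
that `Φ` is non-dilating, hence that `C` is of standard type"; Example 6.1, p. 109: "the assignments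
`L ↦ Φ(L)`, `L ↦ B(L)` determine, respectively, a perf-factorial divisorial monoid `Φ` on `D = B(G)⁰` and a
group-like monoid `B` on `D`". [cite: MochizukiFrdI2008, Thm. 6.2 (iii) p.111]

PROOF-ONLY companion (seat abc-iut-L6-t10) for THE constructed model `geomFrobenioid Γ`
(`GeometricFrobenioidModel.lean`) over abc-iut-L1-t3's interface `GeometricDivisorData` v3. PROVED:
* `GeometricDivisorData.pull_eq_self_of_precsim` — for an endomorphism `σ` of `Spec L` in `D`: if `σ^*` maps
  every Cartier multiple `n · P ∈ Φ(L)` of a prime divisor into its own `≼`-class, then `σ^* = id` on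
  `ℤ_{≥0}[D_L]` (`σ` has finite order; below each prime lies only itself; `σ^* D ≥ D`);
* `geomDivisorFunctor_isNonDilatingOn` — **`Φ` is non-dilating** (Def. 1.1 (ii)), for EVERY `Γ`;
* `not_isOfGroupLikeType_geom'`, `Thm62iii_iff'` — "`C` is not of group-like type" and the reduction of
  t3's `Thm62iii` to its remaining conjuncts, now UNCONDITIONAL (the nonzero divisor comes from v3's
  `exists_phi_ne_zero`, i.e. from `D_K ≠ ∅`);
* `GeometricDivisorData.isSharp_phi`, `geomDivisorFunctor_isMonoidOn`, `geomUnitsFunctor_isMonoidOn` —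
  `Φ(L)` is sharp; `Φ`, `B` are monoids on `D` (`K̃/K` Galois);
* `GeometricDivisorData.isDivisorial_phi_of_sub_mem`, `geom_hypotheses_of`, `geomFrobenioid_isFrobenioid_of`,
  `isOfStandardType_geom_of`, `nonempty_frobeniusPullbackFunctor_iso_of`, `Thm62iii_iff_of_sub_mem` — `Φ(L)`
  divisorial, the hypotheses of Thm. 5.2, "`C_{K̃/K}` is a Frobenioid" (abc-iut-found's Thm. 5.2 (ii)
  `ModelFrobenioid.isFrobenioid`), "`C` is of standard type" (abc-iut-L1-t2's Thm. 5.2 (iii)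
  `ModelFrobenioid.standardTypeIff_holds`), Thm. 6.2 (ii) with its Frobenioid premise discharged, and t3's
  `Thm62iii` reduced to its birationalization / rationally-standard conjuncts — all CONDITIONAL on the closure
  property `Φ(L) = Φ(L)^gp ∩ ℤ_{≥0}[D_L]` ("`Φ(L)^gp` may be identified with the group of Cartier divisors on
  `V[L]`", p. 109, plus normality of `V[L]`: a Cartier divisor that is effective as a Weil divisor is an
  effective Cartier divisor), which is NOT a field of the interface v3 and is taken as the explicit hypothesis
  `hsub` (reported to abc-iut-L1-t3 as a candidate v4 field; everything else is derived).
No definitions; nothing here bears on [IUTchIII] or asserts anything about abc.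
-/

noncomputable section

namespace Literature.AlgebraicGeometry.Frobenioids

open CategoryTheory Opposite Function

variable {K : Type} [Field K] {Kt : Type} [Field Kt] [Algebra K Kt] (Γ : GeometricDivisorData K Kt)

/-! ### `Φ(L)` is sharp and cancellative; divisorial under the closure property -/

namespace GeometricDivisorData

variable (X : FinSubextCat K Kt)

/-- `Φ(L) ⊆ ℤ_{≥0}[D_L]` has no units but `0`. [cite: MochizukiFrdI2008, Ex. 6.1 p.109] -/
theorem isSharp_phi : IsSharp (Multiplicative (Γ.Phi X)) := by
  refine ⟨fun a ha => ?_⟩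
  obtain ⟨u, rfl⟩ := ha
  have h : Multiplicative.toAdd (u : Multiplicative (Γ.Phi X)) +
      Multiplicative.toAdd ((u⁻¹ : (Multiplicative (Γ.Phi X))ˣ) : Multiplicative (Γ.Phi X)) = 0 := by
    rw [← toAdd_mul, Units.mul_inv, toAdd_one]
  have h' := congrArg Subtype.val h
  rw [AddSubmonoid.coe_add, AddSubmonoid.coe_zero, add_eq_zero] at h'
  exact Multiplicative.toAdd.injective (Subtype.ext h'.1)

/-- **Example 6.1: "`Φ(L)` is a divisorial monoid"** (FrdI p. 109) — PROVED from the closure property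
`hsub` (`D, E ∈ Φ(L)`, `E ≤ D` coefficientwise `⇒ D − E ∈ Φ(L)`; on a normal variety a Cartier divisor that is
effective as a Weil divisor is an effective Cartier divisor): `Φ(L)` is then integral, saturated, of
characteristic type and sharp. [cite: MochizukiFrdI2008, Ex. 6.1 p.109] -/
theorem isDivisorial_phi_of_sub_mem
    (hsub : ∀ D E : Γ.primeDiv X →₀ ℕ, D ∈ Γ.Phi X → E ∈ Γ.Phi X → E ≤ D → D - E ∈ Γ.Phi X) :
    IsDivisorial (Multiplicative (Γ.Phi X)) := by
  refine isDivisorial_multiplicative_of (fun a b h => ?_) (fun a b c n hn h => ?_)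
  · have h' := congrArg Subtype.val h
    rw [AddSubmonoid.coe_add, AddSubmonoid.coe_zero, add_eq_zero] at h'
    exact Subtype.ext h'.1
  · have h' := congrArg Subtype.val h
    simp only [AddSubmonoidClass.coe_nsmul, AddSubmonoid.coe_add] at h'
    have hle : (b : Γ.primeDiv X →₀ ℕ) ≤ (a : Γ.primeDiv X →₀ ℕ) := fun P => by
      have := DFunLike.congr_fun h' P
      simp only [Finsupp.coe_smul, Pi.smul_apply, smul_eq_mul, Finsupp.coe_add, Pi.add_apply] at this
      exact Nat.le_of_mul_le_mul_left (by rw [this]; exact Nat.le_add_left _ _) hn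
    refine ⟨⟨(a : Γ.primeDiv X →₀ ℕ) - (b : Γ.primeDiv X →₀ ℕ), hsub _ _ a.2 b.2 hle⟩, Subtype.ext ?_⟩
    rw [AddSubmonoid.coe_add]
    exact (tsub_add_cancel_of_le hle).symm

/-! ### An endomorphism of `Spec L` whose pull-back preserves the primes of `Φ(L)` pulls back trivially -/

/-- Pull-back of coefficient vectors is monotone (coefficient at `Q` is `e(Q|P) ·` coefficient at `P`).
[cite: MochizukiFrdI2008, Ex. 6.1 p.109] -/
theorem pull_monotone {Y : FinSubextCat K Kt} (σ : Y ⟶ X) : Monotone (Γ.pull σ (R := ℕ)) :=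
  fun D E h Q => by rw [pull_apply, pull_apply]; exact Nat.mul_le_mul_left _ (h _)

/-- **Key step of Thm. 6.2 (iii)** ("if `α` induces an automorphism of `Φ(L)` which preserves the primes of `L`,
then … `α` maps every prime divisor `D` to `D` [i.e., not to some `n · D`, where `n ≥ 2`]", FrdI pp. 111–112):
for an endomorphism `σ` of `Spec L` in `D` (a `K`-algebra endomorphism of `L`, of finite order), if `σ^*` maps
each Cartier multiple `n · P ∈ Φ(L)`, `n ≥ 1`, into its own `≼`-class, then `σ^* = id` on `ℤ_{≥0}[D_L]`. PROOF:
supports force `σ` to fix every prime divisor (`over σ = id`), so `(σ^* D)_Q = e_Q · D_Q ≥ D_Q`, and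
`D ≤ σ^* D ≤ ⋯ ≤ (σ^*)^m D = D`. [cite: MochizukiFrdI2008, Thm. 6.2 (iii) p.112] -/
theorem pull_eq_self_of_precsim (σ : X ⟶ X)
    (h : ∀ (P : Γ.primeDiv X) (n : ℕ) (hn : Finsupp.single P n ∈ Γ.Phi X), 0 < n →
      Precsim (Γ.pullPhi σ (Multiplicative.ofAdd ⟨_, hn⟩)) (Multiplicative.ofAdd ⟨_, hn⟩))
    (D : Γ.primeDiv X →₀ ℕ) : Γ.pull σ D = D := by
  classical
  choose k hk0 hk using Γ.qCartier X
  obtain ⟨m, hm, hiter⟩ := EffArithDivisor.exists_iterate_eq_id σ.toAlgHom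
  -- (1) `σ` fixes every prime divisor
  have hover : ∀ P : Γ.primeDiv X, Γ.over σ P = P := fun P => by
    obtain ⟨Q, hQ⟩ := Γ.over_surjective σ P
    have hsub := Γ.support_subset_of_precsim X (h P (k P) (hk P) (hk0 P))
    change (Γ.pull σ (Finsupp.single P (k P))).support ⊆ (Finsupp.single P (k P)).support at hsub
    rw [Finsupp.support_single _ (hk0 P).ne'] at hsub
    have hQmem : Q ∈ (Γ.pull σ (Finsupp.single P (k P))).support := by
      rw [Finsupp.mem_support_iff, pull_apply, hQ, Finsupp.single_eq_same]
      exact (Nat.mul_pos (Γ.ram_pos σ Q) (hk0 P)).ne'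
    have hQP : Q = P := Finset.mem_singleton.mp (hsub hQmem)
    subst hQP
    exact hQ
  -- (2) hence `D ≤ σ^* D`
  have hle : ∀ D : Γ.primeDiv X →₀ ℕ, D ≤ Γ.pull σ D := fun D Q => by
    rw [pull_apply, hover]
    exact Nat.le_mul_of_pos_left _ (Γ.ram_pos σ Q)
  -- (3) `(σ^*)^m = id`: the iterates of `σ^*` are pull-backs along iterates of `σ`
  have hpow : ∀ j : ℕ, ∃ ρ : X ⟶ X, (Γ.pull σ (R := ℕ))^[j] = Γ.pull ρ (R := ℕ) ∧
      (ρ.toAlgHom : X.L → X.L) = (σ.toAlgHom : X.L → X.L)^[j] := by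
    intro j
    induction j with
    | zero => exact ⟨𝟙 X, funext fun E => (Γ.pull_id X E).symm, rfl⟩
    | succ j ih =>
      obtain ⟨ρ, hρ, hρ'⟩ := ih
      refine ⟨ρ ≫ σ, funext fun E => ?_, ?_⟩
      · rw [iterate_succ_apply, hρ, pull_comp]
      · rw [iterate_succ, ← hρ']
        rfl
  obtain ⟨ρ, hρ, hρ'⟩ := hpow m
  have hρ1 : ρ = 𝟙 X := FinSubextCat.hom_ext (AlgHom.ext fun x => by
    have := congrFun hρ' x
    rw [hiter] at this
    exact this)
  have hiter' : (Γ.pull σ (R := ℕ))^[m] = id := by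
    rw [hρ, hρ1]
    funext E
    exact Γ.pull_id X E
  exact eq_self_of_iterate_eq_id_of_le (Γ.pull_monotone X σ) hm hiter' hle D

/-- The same for `σ^*` on `Φ(L)`. [cite: MochizukiFrdI2008, Thm. 6.2 (iii) p.112] -/
theorem pullPhi_eq_self_of_precsim (σ : X ⟶ X)
    (h : ∀ (P : Γ.primeDiv X) (n : ℕ) (hn : Finsupp.single P n ∈ Γ.Phi X), 0 < n →
      Precsim (Γ.pullPhi σ (Multiplicative.ofAdd ⟨_, hn⟩)) (Multiplicative.ofAdd ⟨_, hn⟩))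
    (x : Multiplicative (Γ.Phi X)) : Γ.pullPhi σ x = x :=
  Multiplicative.toAdd.injective (Subtype.ext (by
    rw [coe_toAdd_pullPhi]; exact Γ.pull_eq_self_of_precsim X σ h _))

end GeometricDivisorData

/-! ### `Φ` is non-dilating; `C_{K̃/K}` is not of group-like type -/

/-- **Theorem 6.2 (iii), proof: "`Φ` is non-dilating"** (FrdI pp. 111–112; Def. 1.1 (ii)) — PROVED for the
monoid `Φ` of Example 6.1 on `D = B(Gal(K̃/K))⁰`, for EVERY instance `Γ` of the interface: the primary elements of
`Φ(L)` are the Cartier divisors supported at a single prime divisor (`GeometricDivisorPrimes.lean`), so the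
hypothesis of Def. 1.1 (i) says that `σ^*` preserves the primes of `L`, and then `σ^* = id`
(`GeometricDivisorData.pullPhi_eq_self_of_precsim`). [cite: MochizukiFrdI2008, Thm. 6.2 (iii) p.112] -/
theorem geomDivisorFunctor_isNonDilatingOn : IsNonDilatingOn (geomDivisorFunctor Γ) := by
  intro A α
  refine isNonDilating_of_forall_isPrimary (Γ.isSharp_phi A) _ fun H => ?_
  refine MonoidHom.ext fun x => ?_
  exact Γ.pullPhi_eq_self_of_precsim A α (fun P n hn hn0 =>
    H _ (Γ.isPrimary_of_support_eq_singleton A (s := P) (Finsupp.support_single _ hn0.ne'))) x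

/-- The operations of `C_{K̃/K}` are non-dilating (abc-iut-L1-t3's rendering, via abc-iut-L1-t2's bridge).
[cite: MochizukiFrdI2008, Thm. 6.2 (iii) p.112] -/
theorem geomFrobenioidOps_isNonDilatingOn : (geomFrobenioidOps Γ).IsNonDilatingOn := by
  rw [show geomFrobenioidOps Γ = ModelFrobenioid.data _ _ _ from ModelFrobenioid.ofModel_eq_data _ _ _,
    ModelFrobenioid.data_isNonDilatingOn_iff]
  exact geomDivisorFunctor_isNonDilatingOn Γ

/-- `Φ` is not the zero monoid (`D_K ≠ ∅`, v3's `exists_phi_ne_zero`), so clause (a) of Thm. 5.2 (iii) is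
vacuous. [cite: MochizukiFrdI2008, Thm. 6.2 (iii) p.111] -/
theorem not_isZeroMonoid_geom : ¬ ModelFrobenioid.IsZeroMonoid (geomDivisorFunctor Γ) := by
  intro h
  obtain ⟨X, D, hD⟩ := Γ.exists_phi_ne_zero
  have := h (op X) (Multiplicative.ofAdd D)
  exact hD (by rw [show D = 0 from Multiplicative.ofAdd.injective this]; rfl)

/-- **Theorem 6.2 (iii), "but not of group-like type"** — now UNCONDITIONAL for the constructed `C_{K̃/K}`
(the nonzero Cartier divisor required by `not_isOfGroupLikeType_geom` is supplied by the standing hypothesis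
`D_K ≠ ∅` of Thm. 6.2, v3's `exists_phi_ne_zero`). [cite: MochizukiFrdI2008, Thm. 6.2 (iii) p.111] -/
theorem not_isOfGroupLikeType_geom' : ¬ (geomFrobenioidOps Γ).IsOfGroupLikeType :=
  not_isOfGroupLikeType_geom Γ Γ.exists_phi_ne_zero

/-- **Theorem 6.2 (iii)** for the constructed model, REDUCED unconditionally: t3's `Thm62iii (geomModelFrobenioid Γ)
Bi R` is equivalent to its conjuncts "standard type", "birationally Frobenius-normalized type of `Bi`" and the
rationally-standard clause over `R` (isotropic and not-group-like being PROVED).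
[cite: MochizukiFrdI2008, Thm. 6.2 (iii) p.111] -/
theorem Thm62iii_iff' (Bi : (geomModelFrobenioid Γ).ops.BiratData) (R : (geomModelFrobenioid Γ).ops.RSParams) :
    Thm62iii (geomModelFrobenioid Γ) Bi R ↔
      ((geomFrobenioidOps Γ).IsOfStandardType ∧ PreFrobenioidData.IsOfBiratFrobeniusNormalizedType Bi ∧
        ((∀ (X : FinSubextCat K Kt) (P : Γ.primeDiv X), ∃ f : Γ.B X,
            (Multiplicative.toAdd (Γ.div X f)) P ≠ 0) → (geomFrobenioidOps Γ).IsOfRationallyStandardType R)) :=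
  Thm62iii_iff_of_exists_ne_zero Γ Γ.exists_phi_ne_zero Bi R

/-! ### `Φ`, `B` are monoids on `D`; the hypotheses of Theorem 5.2; standard type -/

section Hypotheses

variable [IsGalois K Kt]

/-- The underlying map of an isomorphism of `CommMonCat` is bijective. [cite: MochizukiFrdI2008, Def. 1.1 (ii) p.19] -/
private theorem bijective_hom_of_isIso_geom {X Y : CommMonCat.{0}} (f : X ⟶ Y) [IsIso f] :
    Bijective f.hom := by
  refine bijective_iff_has_inverse.mpr ⟨(inv f).hom, fun x => ?_, fun y => ?_⟩
  · change (f ≫ inv f).hom x = x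
    rw [IsIso.hom_inv_id]
    rfl
  · change (inv f ≫ f).hom y = y
    rw [IsIso.inv_hom_id]
    rfl

/-- **Example 6.1: `Φ` is a monoid on `D`** (FrdI Def. 1.1 (ii); p. 109) — PROVED for `K̃/K` Galois: pull-backs
are injective (`pullPhi_injective`) into sharp monoids, hence characteristically injective; FSM-morphisms of `D`
are isomorphisms (`FinSubextCat.isOfFSMType`). [cite: MochizukiFrdI2008, Ex. 6.1 p.109] -/
theorem geomDivisorFunctor_isMonoidOn : IsMonoidOn (geomDivisorFunctor Γ) := by
  refine ⟨fun {X Y} σ => ?_, fun {X Y} σ hσ => ?_⟩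
  · have hinj : Injective (pull (geomDivisorFunctor Γ) σ) := Γ.pullPhi_injective σ
    refine ⟨hinj, fun x y hxy => ?_⟩
    obtain ⟨a, rfl⟩ := Associates.mk_surjective x
    obtain ⟨b, rfl⟩ := Associates.mk_surjective y
    rw [associatesMap_mk, associatesMap_mk, Associates.mk_eq_mk_iff_associated] at hxy
    obtain ⟨w, hw⟩ := hxy
    have hw1 : (w : (geomDivisorFunctor Γ).obj (op Y)) = 1 := (Γ.isSharp_phi Y).1 _ w.isUnit
    rw [hw1, mul_one] at hw
    rw [hinj hw]
  · haveI : IsIso σ := (FinSubextCat.isOfFSMType K Kt).isIso_of_isFSM σ hσ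
    haveI : IsIso ((geomDivisorFunctor Γ).map σ.op) := inferInstance
    exact bijective_hom_of_isIso_geom ((geomDivisorFunctor Γ).map σ.op)

/-- **Example 6.1: `B` is a monoid on `D`** (FrdI Def. 1.1 (ii); p. 109) — PROVED for `K̃/K` Galois: `B(M) → B(L)`,
`f ↦ f|_{V[L]}`, is injective (restriction of a field homomorphism) with `B(M)^char` trivial; FSM-morphisms of
`D` are isomorphisms. [cite: MochizukiFrdI2008, Ex. 6.1 p.109] -/
theorem geomUnitsFunctor_isMonoidOn : IsMonoidOn (geomUnitsFunctor Γ) := by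
  refine ⟨fun {X Y} σ => ?_, fun {X Y} σ hσ => ?_⟩
  · refine ⟨fun f g hfg => ?_, ?_⟩
    · have h := congrArg (fun u : Γ.B Y => (((u : Γ.B Y) : (Y.L)ˣ) : Y.L)) hfg
      change (((Γ.mapB σ f : Γ.B Y) : (Y.L)ˣ) : Y.L) = (((Γ.mapB σ g : Γ.B Y) : (Y.L)ˣ) : Y.L) at h
      rw [GeometricDivisorData.coe_mapB, GeometricDivisorData.coe_mapB] at h
      exact Subtype.ext (Units.ext ((σ.toAlgHom : X.L →+* Y.L).injective h))
    · haveI : Subsingleton (Associates ((geomUnitsFunctor Γ).obj (op X))) :=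
        (geomUnitsFunctor_isGroupLike Γ X).subsingleton_associates
      exact injective_of_subsingleton _
  · haveI : IsIso σ := (FinSubextCat.isOfFSMType K Kt).isIso_of_isFSM σ hσ
    haveI : IsIso ((geomUnitsFunctor Γ).map σ.op) := inferInstance
    exact bijective_hom_of_isIso_geom ((geomUnitsFunctor Γ).map σ.op)

/-- **Example 6.1 / Theorem 6.2: the hypotheses of Theorem 5.2 for the geometric data `(Φ, B)`** ("by
Theorem 5.2, (ii), this data determines a [model] Frobenioid", FrdI p. 109) — PROVED for `K̃/K` Galois in
abc-iut-L1-t2's packaging `ModelFrobenioid.Hypotheses`, CONDITIONALLY on the closure property `hsub` of `Φ(L)`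
(through which alone "`Φ(L)` is divisorial" is derived). [cite: MochizukiFrdI2008, Thm. 6.2 p.110] -/
theorem geom_hypotheses_of
    (hsub : ∀ (X : FinSubextCat K Kt) (D E : Γ.primeDiv X →₀ ℕ), D ∈ Γ.Phi X → E ∈ Γ.Phi X → E ≤ D →
      D - E ∈ Γ.Phi X) :
    ModelFrobenioid.Hypotheses (geomDivisorFunctor Γ) (geomUnitsFunctor Γ) where
  isMonoidOn := geomDivisorFunctor_isMonoidOn Γ
  isDivisorial X := Γ.isDivisorial_phi_of_sub_mem X (hsub X)
  isMonoidOn_rat := geomUnitsFunctor_isMonoidOn Γ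
  isGroupLike_rat := geomUnitsFunctor_isGroupLike Γ
  isGraphConnected := FinSubextCat.isGraphConnected K Kt
  isTotallyEpimorphic := FinSubextCat.isTotallyEpimorphic K Kt

/-- **Example 6.1: "by Theorem 5.2, (ii), this data determines a [model] Frobenioid `C_{K̃/K}`"** (FrdI p. 109)
— PROVED for THE constructed `geomFrobenioid Γ` CONDITIONALLY on the closure property `hsub`: abc-iut-found's
Thm. 5.2 (ii) `ModelFrobenioid.isFrobenioid` applied to `geom_hypotheses_of`. [cite: MochizukiFrdI2008, Ex. 6.1 p.109] -/
theorem geomFrobenioid_isFrobenioid_of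
    (hsub : ∀ (X : FinSubextCat K Kt) (D E : Γ.primeDiv X →₀ ℕ), D ∈ Γ.Phi X → E ∈ Γ.Phi X → E ≤ D →
      D - E ∈ Γ.Phi X) :
    PreFrobenioid.IsFrobenioid
      (ModelFrobenioid.toElem (geomDivisorFunctor Γ) (geomUnitsFunctor Γ) (geomDivNatTrans Γ)) :=
  have h := geom_hypotheses_of Γ hsub
  ModelFrobenioid.isFrobenioid h.isMonoidOn h.isDivisorial h.isMonoidOn_rat h.isGroupLike_rat
    h.isGraphConnected h.isTotallyEpimorphic

/-- **Theorem 6.2 (iii): "`C` is of standard type"** (FrdI p. 111; proof p. 112: `D` of FSMFF-type, `Φ`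
non-dilating, `D_K ≠ ∅`) — PROVED for THE constructed `C_{K̃/K}` CONDITIONALLY on the closure property `hsub` of
the interface data: abc-iut-L1-t2's Thm. 5.2 (iii) `ModelFrobenioid.standardTypeIff_holds`, whose three clauses
are discharged here unconditionally — (a) vacuous (`not_isZeroMonoid_geom`), (b) `FinSubextCat.isOfFSMFFType`,
(c) `geomDivisorFunctor_isNonDilatingOn`. [cite: MochizukiFrdI2008, Thm. 6.2 (iii) p.111] -/
theorem isOfStandardType_geom_of
    (hsub : ∀ (X : FinSubextCat K Kt) (D E : Γ.primeDiv X →₀ ℕ), D ∈ Γ.Phi X → E ∈ Γ.Phi X → E ≤ D →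
      D - E ∈ Γ.Phi X) :
    (geomFrobenioidOps Γ).IsOfStandardType := by
  rw [show geomFrobenioidOps Γ = ModelFrobenioid.data _ _ _ from ModelFrobenioid.ofModel_eq_data _ _ _]
  exact (ModelFrobenioid.standardTypeIff_holds _ _ _ (geom_hypotheses_of Γ hsub)).mpr
    ⟨fun h0 => (not_isZeroMonoid_geom Γ h0).elim, FinSubextCat.isOfFSMFFType K Kt,
      geomDivisorFunctor_isNonDilatingOn Γ⟩

/-- **Theorem 6.2 (ii)** with its Frobenioid premise `hF` DISCHARGED (modulo `hsub`): the Frobenius functor on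
`C_{K̃/K}` is isomorphic to the naive Frobenius functor of degree `p` (`Thm62ii_holds`, `GeometricFrobenioidModel.lean`,
at `hF := geomFrobenioid_isFrobenioid_of`). [cite: MochizukiFrdI2008, Thm. 6.2 (ii) p.110] -/
theorem nonempty_frobeniusPullbackFunctor_iso_of
    (hsub : ∀ (X : FinSubextCat K Kt) (D E : Γ.primeDiv X →₀ ℕ), D ∈ Γ.Phi X → E ∈ Γ.Phi X → E ≤ D →
      D - E ∈ Γ.Phi X) (p : ℕ) [Fact p.Prime] [CharP K p] :
    Nonempty (frobeniusPullbackFunctor Γ ⟨p, (Fact.out : p.Prime).pos⟩ ≅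
      PreFrobenioid.naiveFrobeniusOf (geomFrobenioid_isFrobenioid_of Γ hsub) ⟨p, (Fact.out : p.Prime).pos⟩) :=
  Thm62ii_holds Γ p (geomFrobenioid_isFrobenioid_of Γ hsub)

/-- **Theorem 6.2 (iii)** for the constructed model, REDUCED modulo `hsub` to the conjuncts that quote
constructions given only as parameters: birationally Frobenius-normalized type of `Bi` and the rationally-standard
clause over `R` (isotropic, standard and not-group-like being PROVED). [cite: MochizukiFrdI2008, Thm. 6.2 (iii) p.111] -/
theorem Thm62iii_iff_of_sub_mem
    (hsub : ∀ (X : FinSubextCat K Kt) (D E : Γ.primeDiv X →₀ ℕ), D ∈ Γ.Phi X → E ∈ Γ.Phi X → E ≤ D →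
      D - E ∈ Γ.Phi X)
    (Bi : (geomModelFrobenioid Γ).ops.BiratData) (R : (geomModelFrobenioid Γ).ops.RSParams) :
    Thm62iii (geomModelFrobenioid Γ) Bi R ↔
      (PreFrobenioidData.IsOfBiratFrobeniusNormalizedType Bi ∧
        ((∀ (X : FinSubextCat K Kt) (P : Γ.primeDiv X), ∃ f : Γ.B X,
            (Multiplicative.toAdd (Γ.div X f)) P ≠ 0) → (geomFrobenioidOps Γ).IsOfRationallyStandardType R)) := by
  rw [Thm62iii_iff']
  exact ⟨fun h => ⟨h.2.1, h.2.2⟩, fun h => ⟨isOfStandardType_geom_of Γ hsub, h.1, h.2⟩⟩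

end Hypotheses

end Literature.AlgebraicGeometry.Frobenioids

end
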